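import Literature.NumberTheory.GaloisRepresentations.UnramifiedLocalNorms
import Literature.NumberTheory.GaloisRepresentations.HeckeCharacterOfRayClass
import Mathlib.NumberTheory.NumberField.Completion.Ramification
import HarnessLib

/-!
# An admissible modulus: the congruence subgroup of unit ideles consists of norms

Topic `NumberTheory/GaloisRepresentations` (class field theory: the passage from the idelic to
the ideal-theoretic norm index in Childress, *Class Field Theory*, Ch. 4 §5 Thm. 5.12 — "`𝔪`
divisible by a sufficiently high power of every ramified prime" — and Ch. 4 §3 (congruence
subgroups vs. open subgroups of the idèles)); namespace
`Literature.NumberTheory.GaloisRepresentations.IdeleHerbrand`.  Definitions with their API;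
everything **proved**.

For a cyclic (Galois) extension of number fields `E/F`:

* `IdeleHerbrand.conductorExp F E v : ℕ` — an exponent `e_v ≥ 1` at each finite place `v` of `F`
  such that every `x ∈ F_v` with `v(x - 1) ≤ exp(-e_v)` is, diagonally, the norm of an element of
  `∏_{w∣v} 𝒪_wˣ` (`SemiLocalUnits.exists_norm_eq_algebraMap_of_norm_sub_one_le`);
* `IdeleHerbrand.admissibleModulus F E = ∏_{v ramified} 𝔭_v^{e_v}` with
  `admissibleModulus_ne_bot`, `admissibleModulus_le_iff` (`𝔪 ≤ 𝔭_v ↔ v` ramified in `E`) and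
  `le_modulusExp_admissibleModulus`;
* **`IdeleHerbrand.congruenceIdeles_inf_unitIdeles_le_idelicNormSubgroup`** — every unit idele
  of `F` congruent to `1` modulo `𝔪` and positive at the real places is the norm of an idele of
  `E` (`Automorphic.idelicNormSubgroup`): ramified places by the choice of `e_v`, unramified
  finite places by `UnramifiedLocalNorms.lean`, real places through the positive reals
  (`ArchimedeanHerbrand.h0_posReal_eq_one`), complex places since `Ĥ⁰(∏_{w∣v} E_wˣ) = 1` there;
  the local solutions are assembled into an idele (`ofBlocks`, `infiniteIdeles`).

## References

* N. Childress, *Class Field Theory*, Universitext, Springer 2009, Ch. 4 §5 Thm. 5.12 and §3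
  (PDF pp. 81–83, 103). [Childress2009]
-/

noncomputable section

open NumberField IsDedekindDomain NumberField.InfinitePlace
open scoped Valued

namespace Literature.NumberTheory.GaloisRepresentations

namespace IdeleHerbrand

open Literature.NumberTheory.Automorphic

universe u

variable (F : Type u) [Field F] [NumberField F] (E : Type u) [Field E] [NumberField E] [Algebra F E]
variable [IsGalois F E]

/-! ### The exponents and the modulus -/

/-- At every finite place there is an exponent `e ≥ 1` such that `1 + 𝔭_v^e` consists of norms
of elements of `∏_{w∣v} 𝒪_wˣ` (diagonally). [cite: Childress2009, Ch. 4 §5 Thm. 5.12 (PDF p. 103)] -/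
theorem exists_exp_forall_norm_eq (v : HeightOneSpectrum (𝓞 F)) :
    ∃ e : ℕ, 1 ≤ e ∧ ∀ x : v.adicCompletion F, Valued.v (x - 1) ≤ WithZero.exp (-(e : ℤ)) →
      ∃ y ∈ SemiLocal.unitGroup F E v, ((Herbrand.norm (E ≃ₐ[F] E) y : (SemiLocal F E v)ˣ) : SemiLocal F E v) =
        algebraMap (v.adicCompletion F) (SemiLocal F E v) x := by
  obtain ⟨δ, hδ, hδnorm⟩ := SemiLocal.exists_norm_eq_algebraMap_of_norm_sub_one_le (F := F) (E := E) (v := v)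
  obtain ⟨ϖ, hϖ⟩ := v.valuation_exists_uniformizer' F
  set π : v.adicCompletion F := algebraMap (𝓞 F) (v.adicCompletion F) ϖ with hπdef
  have hπv : Valued.v π = WithZero.exp (-1) := by
    rw [hπdef, SemiLocal.valued_algebraMap_ringOfIntegers, ← HeightOneSpectrum.valuation_of_algebraMap (K := F)]
    exact hϖ
  have hπ1 : Valued.v π < 1 := by rw [hπv, ← WithZero.exp_zero, WithZero.exp_lt_exp]; norm_num
  have hπ : ‖π‖ < 1 := (Valued.toNormedField.norm_lt_one_iff).mpr hπ1
  obtain ⟨n₀, hn₀⟩ := exists_pow_lt_of_lt_one hδ hπ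
  refine ⟨max n₀ 1, le_max_right _ _, fun x hx => hδnorm x ?_⟩
  have hπpow : Valued.v (π ^ max n₀ 1) = WithZero.exp (-((max n₀ 1 : ℕ) : ℤ)) := by
    rw [map_pow, hπv, ← WithZero.exp_nsmul]; simp
  have h1 : ‖x - 1‖ ≤ ‖π ^ max n₀ 1‖ := by
    rw [Valued.toNormedField.norm_le_iff, hπpow]; exact hx
  refine h1.trans ?_
  rw [norm_pow]
  exact (pow_le_pow_of_le_one (norm_nonneg _) hπ.le (le_max_left n₀ 1)).trans hn₀.le

/-- **The admissible exponent at `v`.** [cite: Childress2009, Ch. 4 §5 Thm. 5.12 (PDF p. 103)] -/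
def conductorExp (v : HeightOneSpectrum (𝓞 F)) : ℕ := Classical.choose (exists_exp_forall_norm_eq F E v)

/-- `1 ≤ e_v`. [folklore] -/
theorem one_le_conductorExp (v : HeightOneSpectrum (𝓞 F)) : 1 ≤ conductorExp F E v :=
  (Classical.choose_spec (exists_exp_forall_norm_eq F E v)).1

/-- The defining property of `e_v`: `1 + 𝔭_v^{e_v} ⊆ N(∏_{w∣v} 𝒪_wˣ)`. [folklore] -/
theorem exists_norm_eq_of_le_conductorExp (v : HeightOneSpectrum (𝓞 F)) {x : v.adicCompletion F}
    (hx : Valued.v (x - 1) ≤ WithZero.exp (-(conductorExp F E v : ℤ))) :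
    ∃ y ∈ SemiLocal.unitGroup F E v, ((Herbrand.norm (E ≃ₐ[F] E) y : (SemiLocal F E v)ˣ) : SemiLocal F E v) =
      algebraMap (v.adicCompletion F) (SemiLocal F E v) x :=
  (Classical.choose_spec (exists_exp_forall_norm_eq F E v)).2 x hx

/-- The (finite) set of finite places of `F` ramified in `E`. [folklore] -/
def ramifiedFinset : Finset (HeightOneSpectrum (𝓞 F)) :=
  (SemiLocal.finite_setOf_not_isUnramifiedIn' (F := F) (E := E)).toFinset

variable {F E} in
omit [IsGalois F E] in
/-- Membership in `ramifiedFinset`. [folklore] -/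
theorem mem_ramifiedFinset_iff {v : HeightOneSpectrum (𝓞 F)} :
    v ∈ ramifiedFinset F E ↔ ¬ Algebra.IsUnramifiedIn (𝓞 E) v.asIdeal := by
  rw [ramifiedFinset, Set.Finite.mem_toFinset, Set.mem_setOf_eq]

/-- **The admissible modulus `𝔪 = ∏_{v ramified} 𝔭_v^{e_v}`.** [cite: Childress2009, Ch. 4 §5 Thm. 5.12 (PDF p. 103)] -/
def admissibleModulus : Ideal (𝓞 F) := ∏ v ∈ ramifiedFinset F E, v.asIdeal ^ conductorExp F E v

/-- `𝔪 ≠ 0`. [folklore] -/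
theorem admissibleModulus_ne_bot : admissibleModulus F E ≠ ⊥ := by
  rw [admissibleModulus, Ne, ← Ideal.zero_eq_bot, Finset.prod_eq_zero_iff]
  rintro ⟨v, -, hv⟩
  exact (pow_ne_zero _ (by rw [Ideal.zero_eq_bot]; exact v.ne_bot)) hv

variable {F E}

/-- `𝔭_v^{e_v} ∣ 𝔪` for ramified `v`. [folklore] -/
theorem pow_dvd_admissibleModulus {v : HeightOneSpectrum (𝓞 F)} (hv : v ∈ ramifiedFinset F E) :
    v.asIdeal ^ conductorExp F E v ∣ admissibleModulus F E :=
  Finset.dvd_prod_of_mem _ hv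

/-- **`𝔪 ≤ 𝔭_v ↔ v` is ramified in `E`.** [folklore] -/
theorem admissibleModulus_le_iff (v : HeightOneSpectrum (𝓞 F)) :
    admissibleModulus F E ≤ v.asIdeal ↔ ¬ Algebra.IsUnramifiedIn (𝓞 E) v.asIdeal := by
  rw [← mem_ramifiedFinset_iff]
  constructor
  · intro h
    rw [← Ideal.dvd_iff_le, admissibleModulus] at h
    have hprime : Prime v.asIdeal := Ideal.prime_of_isPrime v.ne_bot v.isPrime
    obtain ⟨u, hu, hvu⟩ := (Prime.dvd_finsetProd_iff hprime _).mp h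
    have hvu' : v.asIdeal ∣ u.asIdeal := hprime.dvd_of_dvd_pow hvu
    have : v = u := by
      apply HeightOneSpectrum.ext
      rw [Ideal.dvd_iff_le] at hvu'
      exact (u.isMaximal.eq_of_le v.isPrime.ne_top hvu').symm
    rwa [this]
  · intro hv
    rw [← Ideal.dvd_iff_le]
    exact (dvd_pow_self _ (Nat.one_le_iff_ne_zero.mp (one_le_conductorExp F E v))).trans
      (pow_dvd_admissibleModulus hv)

/-- **`e_v ≤ ν_v(𝔪)`** for ramified `v` (the tree's `modulusExp`). [folklore] -/
theorem le_modulusExp_admissibleModulus {v : HeightOneSpectrum (𝓞 F)} (hv : v ∈ ramifiedFinset F E) :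
    conductorExp F E v ≤ modulusExp (admissibleModulus F E) v := by
  rw [modulusExp, ← Associates.prime_pow_dvd_iff_le (Associates.mk_ne_zero.mpr (admissibleModulus_ne_bot F E))
    ((Associates.irreducible_mk).mpr v.irreducible), ← Associates.mk_pow, Associates.mk_le_mk_iff_dvd]
  exact pow_dvd_admissibleModulus hv

/-! ### Ideles of `E` determined by their infinite part and finite blocks -/

section Blocks

omit [IsGalois F E]

omit [NumberField F] in
/-- An idele of `E` is determined by its infinite part and its blocks above the finite places of
`F`. [folklore] -/
theorem eq_of_infHom_eq_of_forall_blockHom_eq {x x' : ideleGroup E} (hinf : infHom E x = infHom E x')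
    (hfin : ∀ v : HeightOneSpectrum (𝓞 F), blockHom F E v x = blockHom F E v x') : x = x' := by
  apply Units.ext
  refine Prod.ext (congrArg Units.val hinf : _) (FiniteAdeleRing.ext E fun w => ?_)
  have := congrArg (fun u : (SemiLocal F E (w.under (𝓞 F)))ˣ => (u : SemiLocal F E _) ⟨w, rfl⟩) (hfin (w.under (𝓞 F)))
  exact this

/-- The block above `v` of the base change of an idele `w` of `F` is `w_v`, diagonally. [folklore] -/
theorem val_blockHom_ideleBaseChange (w : ideleGroup F) (v : HeightOneSpectrum (𝓞 F)) :
    ((blockHom F E v (AdeleRing.ideleBaseChange F E w) : (SemiLocal F E v)ˣ) : SemiLocal F E v) =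
      algebraMap (v.adicCompletion F) (SemiLocal F E v) ((w : AdeleRing (𝓞 F) F).2 v) := by
  funext w'
  obtain ⟨w', hw'⟩ := w'
  subst hw'
  rw [blockHom_apply, SemiLocal.algebraMap_apply]
  show (AdeleRing.baseChange F E (w : AdeleRing (𝓞 F) F)).2 w' = _
  rw [AdeleRing.baseChange_snd, FiniteAdeleRing.baseChange_apply]
  exact adicCompletionOfUnder_eq F w' (i := SemiLocal.Place.liesOver ⟨w', rfl⟩) rfl _

/-- The block of the base change of a unit idele is a block of units. [folklore] -/
theorem blockHom_ideleBaseChange_mem_unitGroup {w : ideleGroup F} (hw : w ∈ unitIdeles F)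
    (v : HeightOneSpectrum (𝓞 F)) :
    blockHom F E v (AdeleRing.ideleBaseChange F E w) ∈ SemiLocal.unitGroup F E v := fun w' => by
  rw [val_blockHom_ideleBaseChange, SemiLocal.algebraMap_apply, valued_adicCompletionOfLiesOver, hw v, one_pow]

/-- The blocks of a base change are `Gal(E/F)`-fixed. [folklore] -/
theorem smul_blockHom_ideleBaseChange (σ : E ≃ₐ[F] E) (w : ideleGroup F) (v : HeightOneSpectrum (𝓞 F)) :
    σ • blockHom F E v (AdeleRing.ideleBaseChange F E w) = blockHom F E v (AdeleRing.ideleBaseChange F E w) := by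
  rw [← blockHom_smul, AdeleRing.smul_ideleBaseChange]

/-- The infinite components of a base change. [folklore] -/
theorem fst_ideleBaseChange_apply (w : ideleGroup F) (w' : InfinitePlace E) :
    ((AdeleRing.ideleBaseChange F E w : ideleGroup E) : AdeleRing (𝓞 E) E).1 w' =
      infiniteCompletionOfComap F E w' ((w : AdeleRing (𝓞 F) F).1 (w'.comap (algebraMap F E))) := rfl

end Blocks

/-! ### Restricting an archimedean idele to the places above `v` -/

section Restrict

open scoped Classical

omit [IsGalois F E] [NumberField F] [NumberField E]

/-- The part of an archimedean idele of `E` above the infinite place `v` of `F`. [folklore] -/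
def restrictTo (v : InfinitePlace F) (x : (InfiniteAdeleRing E)ˣ) : (InfiniteAdeleRing E)ˣ :=
  (ArchHerbrand.isUnit_of_forall_ne_zero
    (y := fun w' => if ArchHerbrand.IsOver E v w' then (x : InfiniteAdeleRing E) w' else 1) fun w' => by
      by_cases h : ArchHerbrand.IsOver E v w'
      · simp only [h, ↓reduceIte]; exact ArchHerbrand.apply_ne_zero x w'
      · simp only [h, ↓reduceIte]; exact one_ne_zero).unit

/-- Components of `restrictTo`. [folklore] -/
theorem restrictTo_apply (v : InfinitePlace F) (x : (InfiniteAdeleRing E)ˣ) (w' : InfinitePlace E) :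
    (restrictTo (F := F) v x : InfiniteAdeleRing E) w' =
      if ArchHerbrand.IsOver E v w' then (x : InfiniteAdeleRing E) w' else 1 := by
  rw [restrictTo, IsUnit.unit_spec]

/-- `restrictTo v x ∈ infUnits v`. [folklore] -/
theorem restrictTo_mem_infUnits (v : InfinitePlace F) (x : (InfiniteAdeleRing E)ˣ) :
    restrictTo (F := F) v x ∈ ArchHerbrand.infUnits E v := fun w' hw' => by
  rw [restrictTo_apply, if_neg hw']

/-- `restrictTo v` commutes with the Galois action. [folklore] -/
theorem restrictTo_smul (v : InfinitePlace F) (σ : E ≃ₐ[F] E) (x : (InfiniteAdeleRing E)ˣ) :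
    restrictTo (F := F) v (σ • x) = σ • restrictTo (F := F) v x := by
  apply Units.ext; funext w'
  rw [restrictTo_apply, ArchHerbrand.smul_units_apply, ArchHerbrand.smul_units_apply, restrictTo_apply]
  by_cases h : ArchHerbrand.IsOver E v w'
  · rw [if_pos h, if_pos ((ArchHerbrand.isOver_smul_iff σ⁻¹).mpr h)]
  · rw [if_neg h, if_neg (fun h' => h ((ArchHerbrand.isOver_smul_iff σ⁻¹).mp h')), map_one]

/-- `x = ∏_v restrictTo v x`. [folklore] -/
theorem prod_restrictTo [NumberField F] (x : (InfiniteAdeleRing E)ˣ) : ∏ v, restrictTo (F := F) v x = x := by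
  apply Units.ext; funext w'
  rw [Units.coe_prod, ArchHerbrand.prod_apply', Finset.prod_eq_single (w'.comap (algebraMap F E))]
  · rw [restrictTo_apply, if_pos (show ArchHerbrand.IsOver E _ w' from rfl)]
  · intro v _ hv
    rw [restrictTo_apply, if_neg (fun h : ArchHerbrand.IsOver E v w' => hv h.symm)]
  · intro h; exact absurd (Finset.mem_univ _) h

end Restrict

/-! ### The congruence subgroup of unit ideles consists of norms -/

section Norms

open scoped NumberField.LiesOver

variable [FiniteDimensional F E]

/-- **Archimedean blocks are norms**: the part above `v` of the base change of an idele of `F`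
positive at the real places is the norm of an element of `∏_{w∣v} E_wˣ`.
[cite: Childress2009, Ch. 4 §5 Prop. 5.7 (ii) (PDF pp. 98–99)] -/
theorem exists_infUnits_norm_eq_restrictTo {σ : E ≃ₐ[F] E} (hσ : ∀ τ : E ≃ₐ[F] E, τ ∈ Subgroup.zpowers σ)
    (w : ideleGroup F)
    (hpos : ∀ (v : InfinitePlace F) (hv : v.IsReal),
      0 < Completion.extensionEmbeddingOfIsReal hv ((w : AdeleRing (𝓞 F) F).1 v))
    (v : InfinitePlace F) :
    ∃ Y ∈ ArchHerbrand.infUnits E v,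
      Herbrand.norm (E ≃ₐ[F] E) Y = restrictTo (F := F) v (infHom E (AdeleRing.ideleBaseChange F E w)) := by
  set u := restrictTo (F := F) v (infHom E (AdeleRing.ideleBaseChange F E w)) with hu
  have hufix : ∀ g : E ≃ₐ[F] E, g • u = u := fun g => by
    rw [hu, ← restrictTo_smul, ← infHom_smul, AdeleRing.smul_ideleBaseChange]
  rcases v.isReal_or_isComplex with hv | hv
  · -- real place: positive reals are norms
    have hupos : u ∈ ArchHerbrand.posReal E v := by
      refine ⟨restrictTo_mem_infUnits v _, fun w' => ?_⟩
      by_cases hw' : ArchHerbrand.IsOver E v w'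
      · have hvw : (w'.comap (algebraMap F E)).IsReal := by rw [show w'.comap (algebraMap F E) = v from hw']; exact hv
        refine ⟨Completion.extensionEmbeddingOfIsReal hvw ((w : AdeleRing (𝓞 F) F).1 (w'.comap (algebraMap F E))), ?_, ?_⟩
        · have := hpos (w'.comap (algebraMap F E)) hvw
          exact this
        · rw [hu, restrictTo_apply, if_pos hw']
          show Completion.extensionEmbedding w' (((AdeleRing.ideleBaseChange F E w : ideleGroup E) :
            AdeleRing (𝓞 E) E).1 w') = _
          rw [fst_ideleBaseChange_apply, Completion.extensionEmbeddingOfIsReal_apply]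
          haveI : w'.1.LiesOver (w'.comap (algebraMap F E)).1 := ⟨rfl⟩
          haveI := LiesOver.extensionEmbedding_liesOver_of_isReal (w := w') (v := w'.comap (algebraMap F E)) hvw
          exact Completion.liesOver_extensionEmbedding_apply w' (w'.comap (algebraMap F E))
      · refine ⟨1, one_pos, ?_⟩
        rw [hu, restrictTo_apply, if_neg hw', map_one, Complex.ofReal_one]
    have h0 := ArchHerbrand.h0_posReal_eq_one (E := E) hσ v
    rw [Herbrand.h0_eq_one_iff] at h0
    have := h0 u hupos (by rw [Subgroup.mem_bot, hufix σ, div_self'])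
    rw [Herbrand.b0_bot] at this
    obtain ⟨Y, hY, hYu⟩ := this
    exact ⟨Y, ArchHerbrand.posReal_le_infUnits v hY, hYu⟩
  · -- complex place: `Ĥ⁰(∏_{w∣v} E_wˣ) = 1`
    set w₀ := ArchHerbrand.placeOver E v
    have hw₀ : ArchHerbrand.IsOver E v w₀ := ArchHerbrand.isOver_placeOver v
    have hunr : w₀.IsUnramified F := by
      by_contra hram
      have := (InfinitePlace.isRamified_iff.mp hram).2
      rw [show w₀.comap (algebraMap F E) = v from hw₀] at this
      exact (InfinitePlace.not_isReal_iff_isComplex.mpr hv) this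
    have h0 := ArchHerbrand.h0_infUnits_eq_card_stabilizer (E := E) hσ hw₀
    rw [hunr.stabilizer_eq_bot, Subgroup.card_bot, Herbrand.h0_eq_one_iff] at h0
    have := h0 u (restrictTo_mem_infUnits v _) (by rw [Subgroup.mem_bot, hufix σ, div_self'])
    rw [Herbrand.b0_bot] at this
    obtain ⟨Y, hY, hYu⟩ := this
    exact ⟨Y, hY, hYu⟩

/-- **Finite blocks are norms**: for `w ∈ W_𝔪 ∩ 𝓔_F` the block above `v` of its base change is the
norm of an element of `∏_{w'∣v} 𝒪_{w'}ˣ` (ramified `v`: by the choice of `e_v`; unramified `v`: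
`UnramifiedLocalNorms.lean`). [cite: Childress2009, Ch. 4 §5 Thm. 5.12 (PDF p. 103)] -/
theorem exists_unitGroup_norm_eq_blockHom {w : ideleGroup F}
    (hw : w ∈ congruenceIdeles (admissibleModulus F E) ⊓ unitIdeles F) (v : HeightOneSpectrum (𝓞 F)) :
    ∃ y ∈ SemiLocal.unitGroup F E v,
      Herbrand.norm (E ≃ₐ[F] E) y = blockHom F E v (AdeleRing.ideleBaseChange F E w) := by
  by_cases hv : v ∈ ramifiedFinset F E
  · have hmod : modulusExp (admissibleModulus F E) v ≠ 0 := fun h0 => by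
      have := le_modulusExp_admissibleModulus (F := F) (E := E) hv
      rw [h0] at this
      exact absurd (one_le_conductorExp F E v) (by omega)
    have hcong := (mem_congruenceIdeles_iff.mp hw.1).1 v hmod
    have hle : Valued.v ((w : AdeleRing (𝓞 F) F).2 v - 1) ≤ WithZero.exp (-(conductorExp F E v : ℤ)) := by
      refine hcong.trans ?_
      rw [WithZero.exp_le_exp, neg_le_neg_iff, Nat.cast_le]
      exact le_modulusExp_admissibleModulus hv
    obtain ⟨y, hy, hNy⟩ := exists_norm_eq_of_le_conductorExp F E v hle
    exact ⟨y, hy, Units.ext (hNy.trans (val_blockHom_ideleBaseChange (E := E) w v).symm)⟩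
  · exact SemiLocal.exists_unitGroup_norm_eq_of_isUnramifiedIn (not_not.mp (mem_ramifiedFinset_iff.not.mp hv))
      (blockHom_ideleBaseChange_mem_unitGroup hw.2 v) (fun g => smul_blockHom_ideleBaseChange g w v)

/-- **The congruence subgroup of unit ideles of the admissible modulus consists of norms**:
`W_𝔪 ∩ 𝓔_F ≤ N(𝔸_Eˣ) ∩ 𝔸_Fˣ` (`Automorphic.idelicNormSubgroup`), for `E/F` cyclic and
`𝔪 = admissibleModulus F E`. [cite: Childress2009, Ch. 4 §5 Thm. 5.12 (PDF p. 103)] -/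
theorem congruenceIdeles_inf_unitIdeles_le_idelicNormSubgroup {σ : E ≃ₐ[F] E}
    (hσ : ∀ τ : E ≃ₐ[F] E, τ ∈ Subgroup.zpowers σ) :
    congruenceIdeles (admissibleModulus F E) ⊓ unitIdeles F ≤ idelicNormSubgroup F E := by
  classical
  intro w hw
  -- finite blocks
  have hfin := exists_unitGroup_norm_eq_blockHom (E := E) hw
  choose yf hyf hNyf using hfin
  set Xf : ideleGroup E := ofBlocks yf hyf ∅ with hXf
  have hXf_block : ∀ v, blockHom F E v Xf = yf v := fun v => blockHom_ofBlocks yf hyf (Finset.notMem_empty v)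
  have hXf_inf : infHom E Xf = 1 := Units.ext (ofBlocks_fst yf hyf (S := ∅))
  -- infinite blocks
  have hinf := exists_infUnits_norm_eq_restrictTo (E := E) hσ w (mem_congruenceIdeles_iff.mp hw.1).2
  choose Y hY hNY using hinf
  set Xi : ideleGroup E := infiniteIdeles E (∏ v, Y v) with hXi
  have hXi_inf : infHom E Xi = ∏ v, Y v := infHom_infiniteIdeles _
  have hXi_block : ∀ v, blockHom F E v Xi = 1 := fun v => Units.ext (funext fun w' => rfl)
  -- the preimage
  refine mem_idelicNormSubgroup_iff.mpr ⟨Xi * Xf, ?_⟩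
  rw [← norm_eq_ideleGalNorm]
  refine eq_of_infHom_eq_of_forall_blockHom_eq (F := F) ?_ (fun v => ?_)
  · rw [Herbrand.map_norm_eq (infHom E) (fun g y => infHom_smul g y), map_mul, hXi_inf, hXf_inf, mul_one,
      map_prod]
    conv_rhs => rw [← prod_restrictTo (F := F) (infHom E (AdeleRing.ideleBaseChange F E w))]
    exact Finset.prod_congr rfl fun v _ => hNY v
  · rw [blockHom_norm, map_mul, hXi_block, hXf_block, one_mul, hNyf]

end Norms

end IdeleHerbrand

end Literature.NumberTheory.GaloisRepresentations
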